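import Summits.ResolutionOfSingularities.ResolutionOfSingularities.Theorems.HoleCutClasses
import Summits.ResolutionOfSingularities.ResolutionOfSingularities.Theorems.CoefficientCutClasses
import HarnessLib

/-!
# FreezeCutClasses — decomp-res node «FreezeCut» (lens-3 g19 rev 2, critic rows 149/149a/149b), tree file 4/5 of the node

Content VERBATIM from the decomp-res lens-3 g19 TREE-FACING COMPANION
`HOME/decomp-res-lens-3/g19/tree/FreezeCutTree.lean` (rev 3 pin
7e31fb5a…, 1 296 l; = node `FreezeCut.lean` rev 2 pin c7927053 NEW PART ONLY, l. 3728–4969; HOME =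
run/shared/lean/pub/decomp-res).  Critic:
CRITIC-LEDGER rows 149 (rev 1 ca88d448 CLEARED, DECIDED +1: window (α′)), 149a (rev 2 c7927053 CLEARED, DECIDED
+1: window (β″); rev 2 SUPERSEDES
ca88d448 as landing source) and 149b (companion 7e31fb5a CLEARED as the landing vehicle; orders 2026-08-30T22:14:37Z
/ 22:25:58Z / 22:27:55Z).
Landed by decomp-res writer g8 split for the 400-line limit exactly as rows 149/149a/149b say: `FreezeCutConeVars`
(§V), `FreezeCutLaw` (§F),
`FreezeCutHalf` (§H) in the LANDED namespace `…Theorems.HoleCut` (they extend the tree theory of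
`HoleCut.TailShade`, hence sit behind
`MaxContactCutHoleCut` INSIDE the Theses cone); `FreezeCutClasses` (the cone-free classes of §K5/§K6 and their
letter-only kernels; namespace
`…Theorems.FreezeCut`; imports `HoleCutClasses` + `CoefficientCutClasses` only — OUTSIDE the cone, importable by
the route file) and the in-cone
wiring file `MaxContactCutFreezeCut` (§K5/§K6 booking theorems over the laws and the MaxContactCut asides BY
NAME).  The companion's trailing §M
`closes` (≡ the tree's `MaxContactCutExponentLadder.closes` VERBATIM) is not re-landed.  All `--supports
stmt-ResolutionOfSingularities-31770`
(host aside `MaxContactCut.DefectWalksDeep`).  Route bookkeeping: NO new aside (critic rows 149/149a); the host item 28532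
`TightNoJointTailsFromFourDeep` is re-informalled: piece B `NoHoleFillingTailsDeep` PROVED
(`FreezeCut.noHoleFillingTails_holds`), the located
residual is piece A `NoSubcriticalJointTailsDeep` ≡ A₁⁺ ∧ A₂⁺ (`sub_iff_highPlanar_highSkew`) ≡
lens-5's planar ∧ skew (`joint_iff_planar_skew`).

THE CONE-FREE CLASSES of §K5/§K6 VERBATIM — `NoSupercriticalJointTailsDeep` (THE DECIDED WINDOW (α′)),
`NoSubcriticalPlanarJointTailsDeep` (A₁),
`NoSubcriticalSkewJointTailsDeep` (A₂, located residual), `NoLowJointTailsDeep` (THE DECIDED WINDOW (β″)),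
`NoHighPlanarJointTailsDeep` (A₁⁺),
`NoHighSkewJointTailsDeep` (A₂⁺, THE located residual of rev 2) — with their letter-only kernels (monotonicity
/ exactness between the classes
and lens-5's `CoefficientCut.NoPlanarJointTailsDeep` / `NoSkewJointTailsDeep` and the tree's joint residual).
Namespace `…Theorems.FreezeCut`.
OUTSIDE the Theses cone (imports `HoleCutClasses`, `CoefficientCutClasses` only; the kernels that quote the tree's
joint residual `ExitLaw.…`
(in-cone via `NoJump`) are in the wiring file).  0 sorry.

## The lens's companion description (VERBATIM)

# FreezeCutTree — TREE-FACING COMPANION of lens-3 g19 «FreezeCut» rev 2 (pin c7927053): the node's NEW PART ONLY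
(§V cone variables, §F the freezing law, §K5 booking + cross-axis law, §H the half-critical freezing law, §K6 its booking,
§M `closes` VERBATIM), byte-identical to `FreezeCut.lean` rev 2 l. 3728–4969, written against the LANDED tree modules
`Theorems.HoleCut*` / `MaxContactCutHoleCut` (writer-1 g7, 2026-08-30T22:08Z: `TailShade`, `HasZero`, the deficit window,
LAW J⁺, poverty, `HoleCutClasses` pieces A/B, `four_iff_hole`, `defectWalksDeep_iff_hole`) and
`Theorems.CoefficientCutClasses`
(lens-5 g19) — NO carried copy.  This is writer-1's landing unit for NODE-g19 §6 (split as the writer chooses: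
FreezeCutConeVars ← §V, FreezeCutLaw ← §F, FreezeCutHalf ← §H, FreezeCutClasses ← the six cone-free
`def`s, MaxContactCutFreezeCut ←
the booking theorems `--supports stmt-ResolutionOfSingularities-31770 --as helper`).  Namespace `…Theorems.FreezeCut` with
`open …Theorems.HoleCut`: the new `TailShade.*` theorems therefore live in `…FreezeCut.TailShade` and are
invoked by explicit
application, never by dot-notation on a `HoleCut.TailShade` hypothesis (as in the node).  See `FreezeCut.lean` for
the full module
docstring (thesis, mechanism, tags, probes). 

[WRITER NOTE (decomp-res writer g8): section split only; namespaces, opens, section variables and every declaration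
exactly as in the
companion (its global `linter.dupNamespace` option line dropped).]

(Sources: Hauser2010; Moh1987; CossartPiltant2008I; BenitoVillamayor2012; KawanoueMatsuki2010; HironakaBowdoin2005.)
-/

noncomputable section

open MvPolynomial Finset
open Literature.AlgebraicGeometry.Resolution
open Literature.AlgebraicGeometry.Resolution.Hauser2010
open Literature.AlgebraicGeometry.Resolution.PointBlowup
open Literature.AlgebraicGeometry.Resolution.WeightedBlowup
open Summit.ResolutionOfSingularities.ResolutionOfSingularities.Theorems.TightDefectClasses
open Summit.ResolutionOfSingularities.ResolutionOfSingularities.Theorems.ProximityCut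
open Summit.ResolutionOfSingularities.ResolutionOfSingularities.Theorems.TightCut
open Summit.ResolutionOfSingularities.ResolutionOfSingularities.Theorems.HoleCut

namespace Summit.ResolutionOfSingularities.ResolutionOfSingularities.Theorems.FreezeCut

/-! ## §K5 BOOKING (g19) — PIECE B EMPTIED IN KERNEL; THE RESIDUAL IS «SUBCRITICAL JOINT TAILS»; THE CROSS-AXIS LAW
WITH LENS-5 (PLANAR and SKEW joint tails are SUBCRITICAL).

`noSupercriticalJointTails_holds` (THE DECIDED WINDOW: ALL supercritical joint tails, `3s ≤ p^e + 2`, every shade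
`s ≥ 1` at once, HYPOTHESIS-FREE) ⊇ by letter g18's piece B (`noHoleFillingTails_holds`) and g18's hole-free window.
EXACT: the tree's joint residual ≡ g18's piece A ALONE (`joint_iff_sub`); 31770 ≡ deep arc law ∧ piece A
(`defectWalksDeep_iff_sub`, THE ONE CERTIFIED EQUIVALENCE OF THIS NODE).  CROSS-AXIS (criticality × lens-5's
planar/skew letters, load-bearing): lens-5's planar window ≡ its subcritical part, lens-5's skew residual ≡ its
subcritical part (`planar_iff_subPlanar`, `skew_iff_subSkew`), and piece A ≡ subcritical-planar ∧ subcritical-skew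
(`sub_iff_subPlanar_subSkew`); composed: `defectWalksDeep_iff_subPlanar_subSkew`. -/

section BookingFreeze

/-- THE DECIDED WINDOW OF g19 · **SUPERCRITICAL JOINT TAILS, EVERY SHADE** · binders of the tree's joint residual
`ExitLaw.NoRepeatTranslationRecurrentExcessPlateauxDeep` VERBATIM + `shade_N = s`, `3s ≤ p^e + 2` · WEAKER than the
joint residual by letter (`supercritical_of_joint`) · **DECIDED — PROVED EMPTY, HYPOTHESIS-FREE**
(`noSupercriticalJointTails_holds` = §F `TailShade.no_joint`: the freezing law + (F3) + lens-5's landed wall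
potential `PlanarCut.noPlanarTails`) · contains by letter g18's piece B and g18's hole-free window, and the census
cells `(16,4)`, `(16,5)`, `(16,6)` of T-planar-q16 (0/180 both-letter plateaux observed there — now a theorem). -/
def NoSupercriticalJointTailsDeep : Prop :=
  ∀ p : ℕ, p.Prime → ∀ e : ℕ, 2 ≤ e → ∀ (K : Type) [Field K] [CharP K p] [PerfectField K] [DecidableEq K]
    (s₀ : State (Fin 3) K), IsRoot (p ^ e) s₀ → ∀ W : ForcedWalk (p ^ e) s₀, (∀ i, 1 ≤ (W.st i).shade) →
    ∀ N : ℕ, (∀ t, N ≤ t → (W.st (t + 1)).shade = (W.st t).shade) →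
    (∀ t, N ≤ t → ordZero (W.st t).F ≠ ((p ^ e : ℕ) : ℕ∞)) → (∀ M : ℕ, ∃ t, M ≤ t ∧ StaysOnNewest W t) →
    (∀ M : ℕ, ∃ t, M ≤ t ∧ W.b t ≠ 0) →
    ∀ s : ℕ, (W.st N).shade = (s : ℕ∞) → 3 * s ≤ p ^ e + 2 → False

/-! ### The cross-axis law with lens-5 (criticality × planar/skew) -/

/-- PIECE A₁ · **SUBCRITICAL PLANAR JOINT TAILS** · piece A's binders VERBATIM + lens-5's planar letter
(`CoefficientCut.NoPlanarJointTailsDeep`'s conclusion: a wall `u_k` never charted and never translated from some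
stage on; ghost walls included) · WEAKER than piece A (`subPlanar_of_sub`) AND than lens-5's planar window
(`subPlanar_of_planar`) by letter · EXACT: `planar_iff_subPlanar` (lens-5's planar window IS its subcritical part) ·
tags: DECIDED-MOD-PORT exactly as lens-5's piece 1′ (`CoefficientCutClasses`: `noPlanarJointTails_of_monomial`,
`planar_iff_monomial`, port of BenitoVillamayor2012) · its massive-wall part (`r_N(k) ≥ 1`) is lens-5's landed
theorem `PlanarCut.noPlanarTails`; the residue is the HIGH-SHADE GHOST wall (EXACT `subPlanar_iff_highPlanar`, §K6). -/
def NoSubcriticalPlanarJointTailsDeep : Prop :=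
  ∀ p : ℕ, p.Prime → ∀ e : ℕ, 2 ≤ e → ∀ (K : Type) [Field K] [CharP K p] [PerfectField K] [DecidableEq K]
    (s₀ : State (Fin 3) K), IsRoot (p ^ e) s₀ → ∀ W : ForcedWalk (p ^ e) s₀, (∀ i, 1 ≤ (W.st i).shade) →
    ∀ N : ℕ, (∀ t, N ≤ t → (W.st (t + 1)).shade = (W.st t).shade) →
    (∀ t, N ≤ t → ordZero (W.st t).F ≠ ((p ^ e : ℕ) : ℕ∞)) → (∀ M : ℕ, ∃ t, M ≤ t ∧ StaysOnNewest W t) →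
    (∀ M : ℕ, ∃ t, M ≤ t ∧ W.b t ≠ 0) →
    ∀ s : ℕ, (W.st N).shade = (s : ℕ∞) → 3 ≤ s → p ^ e + 3 ≤ 3 * s →
    ∀ (k : Fin 3) (N' : ℕ), (∀ t, N' ≤ t → W.j t ≠ k ∧ W.b t k = 0) → False

/-- PIECE A₂ · THE LOCATED RESIDUAL OF BOTH LENSES · **SUBCRITICAL SKEW JOINT TAILS** · piece A's binders VERBATIM +
lens-5's skew letter (every coordinate plane is, infinitely often, the chart or a direction of translation) · WEAKER
than piece A (`subSkew_of_sub`) AND than lens-5's skew residual `CoefficientCut.NoSkewJointTailsDeep`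
(`subSkew_of_skew`) by letter · EXACT: `skew_iff_subSkew` (lens-5's skew residual IS its subcritical part) ·
UNDECIDED · its LOW-SHADE part `2s ≤ p^e` is EMPTY by the half-critical law of §H, EXACT `subSkew_iff_highSkew`
(§K6): the leaf is A₂⁺ `NoHighSkewJointTailsDeep` (`2s ≥ p^e + 1`) · INSTRUMENTABLE (the shadow ledger automaton has
skew both-letter cycles exactly at the cells `2s ≥ q + 1` and none below; in the census both-letter excess plateaux
are all but uninhabited: T-stallvertex (b) 2 runs universe-wide, T-planar-q16 0/429). -/
def NoSubcriticalSkewJointTailsDeep : Prop :=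
  ∀ p : ℕ, p.Prime → ∀ e : ℕ, 2 ≤ e → ∀ (K : Type) [Field K] [CharP K p] [PerfectField K] [DecidableEq K]
    (s₀ : State (Fin 3) K), IsRoot (p ^ e) s₀ → ∀ W : ForcedWalk (p ^ e) s₀, (∀ i, 1 ≤ (W.st i).shade) →
    ∀ N : ℕ, (∀ t, N ≤ t → (W.st (t + 1)).shade = (W.st t).shade) →
    (∀ t, N ≤ t → ordZero (W.st t).F ≠ ((p ^ e : ℕ) : ℕ∞)) → (∀ M : ℕ, ∃ t, M ≤ t ∧ StaysOnNewest W t) →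
    (∀ M : ℕ, ∃ t, M ≤ t ∧ W.b t ≠ 0) →
    ∀ s : ℕ, (W.st N).shade = (s : ℕ∞) → 3 ≤ s → p ^ e + 3 ≤ 3 * s →
    (∀ (k : Fin 3) (N' : ℕ), ∃ t, N' ≤ t ∧ (W.j t = k ∨ W.b t k ≠ 0)) → False

/-- By letter. [folklore] -/
theorem subPlanar_of_sub (h : NoSubcriticalJointTailsDeep) : NoSubcriticalPlanarJointTailsDeep :=
  fun p hp e he K _ _ _ _ s₀ hs W hW N hN hex hrec htr s hsN h3 hsub _ _ _ =>
    h p hp e he K s₀ hs W hW N hN hex hrec htr s hsN h3 hsub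

/-- By letter. [folklore] -/
theorem subSkew_of_sub (h : NoSubcriticalJointTailsDeep) : NoSubcriticalSkewJointTailsDeep :=
  fun p hp e he K _ _ _ _ s₀ hs W hW N hN hex hrec htr s hsN h3 hsub _ =>
    h p hp e he K s₀ hs W hW N hN hex hrec htr s hsN h3 hsub

/-- By letter. [folklore] -/
theorem subPlanar_of_planar (h : CoefficientCut.NoPlanarJointTailsDeep) : NoSubcriticalPlanarJointTailsDeep :=
  fun p hp e he K _ _ _ _ s₀ hs W hW N hN hex hrec htr _ _ _ _ k N' hP =>
    h p hp e he K s₀ hs W hW N hN hex hrec htr k N' hP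

/-- By letter. [folklore] -/
theorem subSkew_of_skew (h : CoefficientCut.NoSkewJointTailsDeep) : NoSubcriticalSkewJointTailsDeep :=
  fun p hp e he K _ _ _ _ s₀ hs W hW N hN hex hrec htr _ _ _ _ hsk =>
    h p hp e he K s₀ hs W hW N hN hex hrec htr hsk

/-- **SUFFICIENCY (PROVED)**: a subcritical joint tail is planar along some wall or skew. [new] [folklore] -/
theorem sub_of_subPlanar_subSkew (h₁ : NoSubcriticalPlanarJointTailsDeep) (h₂ : NoSubcriticalSkewJointTailsDeep) :
    NoSubcriticalJointTailsDeep := by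
  intro p hp e he K _ _ _ _ s₀ hs W hW N hN hex hrec htr s hsN h3 hsub
  classical
  by_cases hpl : ∃ (k : Fin 3) (N' : ℕ), ∀ t, N' ≤ t → W.j t ≠ k ∧ W.b t k = 0
  · obtain ⟨k, N', hP⟩ := hpl
    exact h₁ p hp e he K s₀ hs W hW N hN hex hrec htr s hsN h3 hsub k N' hP
  · refine h₂ p hp e he K s₀ hs W hW N hN hex hrec htr s hsN h3 hsub fun k N' => ?_
    by_contra hno
    push Not at hno
    exact hpl ⟨k, N', fun t ht => hno t ht⟩

/-- **EXACT (PROVED)**: piece A ≡ subcritical-planar ∧ subcritical-skew (the split of the residual by lens-5's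
letter). [new] [folklore] -/
theorem sub_iff_subPlanar_subSkew :
    NoSubcriticalJointTailsDeep ↔ NoSubcriticalPlanarJointTailsDeep ∧ NoSubcriticalSkewJointTailsDeep :=
  ⟨fun h => ⟨subPlanar_of_sub h, subSkew_of_sub h⟩, fun h => sub_of_subPlanar_subSkew h.1 h.2⟩

end BookingFreeze

/-! ## §K6 BOOKING OF THE HALF-CRITICAL LAW (g19 rev 2) — THE LOW-SHADE WINDOW `2s ≤ p^e` IS EMPTY; THE RESIDUAL IS
«HIGH-SHADE SKEW JOINT TAILS» (`2s ≥ p^e + 1`: the residual cone has degree MORE THAN HALF the modulus)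

`noLowJointTails_holds` (DECIDED, hypothesis-free, every shade: no joint tails with `2s ≤ p^e`) ⊇ by letter the
supercritical window of §K5.  EXACT re-locations one level down: A₁ ≡ A₁⁺ (`subPlanar_iff_highPlanar`),
A₂ ≡ A₂⁺
(`subSkew_iff_highSkew`), lens-5's classes likewise (`planar_iff_highPlanar`, `skew_iff_highSkew`), the joint
residual ≡ A₁⁺ ∧ A₂⁺ (`joint_iff_highPlanar_highSkew`), 31770 ≡ deep arc law ∧ A₁⁺ ∧ A₂⁺
(`defectWalksDeep_iff_highPlanar_highSkew`). -/

section BookingHalf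

/-- THE DECIDED WINDOW OF g19 rev 2 · **LOW-SHADE JOINT TAILS** · joint binders VERBATIM + `shade_N = s`, `2s ≤ p^e` ·
WEAKER than the joint residual by letter (`low_of_joint`) · **DECIDED — PROVED EMPTY, HYPOTHESIS-FREE, every shade**
(`noLowJointTails_holds` = §H `TailShade.no_joint'`: the half-critical freezing law) · contains the supercritical
window `NoSupercriticalJointTailsDeep` of §K5 and the subcritical cells `(8,4)`, `(9,4)`, `(11,5)`, `(13,6)`, `(16,7)`,
`(16,8)`, `(25,10…12)`, `(27,10…13)`, … [new] -/
def NoLowJointTailsDeep : Prop :=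
  ∀ p : ℕ, p.Prime → ∀ e : ℕ, 2 ≤ e → ∀ (K : Type) [Field K] [CharP K p] [PerfectField K] [DecidableEq K]
    (s₀ : State (Fin 3) K), IsRoot (p ^ e) s₀ → ∀ W : ForcedWalk (p ^ e) s₀, (∀ i, 1 ≤ (W.st i).shade) →
    ∀ N : ℕ, (∀ t, N ≤ t → (W.st (t + 1)).shade = (W.st t).shade) →
    (∀ t, N ≤ t → ordZero (W.st t).F ≠ ((p ^ e : ℕ) : ℕ∞)) → (∀ M : ℕ, ∃ t, M ≤ t ∧ StaysOnNewest W t) →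
    (∀ M : ℕ, ∃ t, M ≤ t ∧ W.b t ≠ 0) →
    ∀ s : ℕ, (W.st N).shade = (s : ℕ∞) → 2 * s ≤ p ^ e → False

/-- PIECE A₁⁺ · **HIGH-SHADE PLANAR JOINT TAILS** · A₁'s binders VERBATIM + `p^e + 1 ≤ 2s` · WEAKER than
A₁ by letter
(`highPlanar_of_subPlanar`) · EXACT `subPlanar_iff_highPlanar`, `planar_iff_highPlanar` · DECIDED-MOD-PORT exactly as
lens-5's piece 1′ (its massive-wall part is lens-5's landed theorem; the residue is the high-shade GHOST wall). -/
def NoHighPlanarJointTailsDeep : Prop :=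
  ∀ p : ℕ, p.Prime → ∀ e : ℕ, 2 ≤ e → ∀ (K : Type) [Field K] [CharP K p] [PerfectField K] [DecidableEq K]
    (s₀ : State (Fin 3) K), IsRoot (p ^ e) s₀ → ∀ W : ForcedWalk (p ^ e) s₀, (∀ i, 1 ≤ (W.st i).shade) →
    ∀ N : ℕ, (∀ t, N ≤ t → (W.st (t + 1)).shade = (W.st t).shade) →
    (∀ t, N ≤ t → ordZero (W.st t).F ≠ ((p ^ e : ℕ) : ℕ∞)) → (∀ M : ℕ, ∃ t, M ≤ t ∧ StaysOnNewest W t) →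
    (∀ M : ℕ, ∃ t, M ≤ t ∧ W.b t ≠ 0) →
    ∀ s : ℕ, (W.st N).shade = (s : ℕ∞) → 3 ≤ s → p ^ e + 3 ≤ 3 * s → p ^ e + 1 ≤ 2 * s →
    ∀ (k : Fin 3) (N' : ℕ), (∀ t, N' ≤ t → W.j t ≠ k ∧ W.b t k = 0) → False

/-- PIECE A₂⁺ · THE LOCATED RESIDUAL OF BOTH LENSES AFTER g19 rev 2 · **HIGH-SHADE SKEW JOINT TAILS** · A₂'s binders
VERBATIM + `p^e + 1 ≤ 2s` (the residual cone `Φ_t`, a ternary form of degree `s`, has degree MORE THAN HALF the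
modulus) · WEAKER than A₂ by letter (`highSkew_of_subSkew`) · EXACT `subSkew_iff_highSkew`, `skew_iff_highSkew` ·
UNDECIDED · INSTRUMENTABLE (cells `(4,3)`, `(8,5…7)`, `(9,5…8)`, `(16,9…15)`, `(25,13…)`, `(27,14…)`; the shadow
ledger automaton HAS skew both-letter cycles at every such cell, so no ledger/cone-support law decides it: the content
is in the COEFFICIENTS of the cone — lens-5's vertex/origin laws, lens-4's valuative side) · leaf: IDEA-NEEDED ∧
INSTRUMENTABLE. -/
def NoHighSkewJointTailsDeep : Prop :=
  ∀ p : ℕ, p.Prime → ∀ e : ℕ, 2 ≤ e → ∀ (K : Type) [Field K] [CharP K p] [PerfectField K] [DecidableEq K]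
    (s₀ : State (Fin 3) K), IsRoot (p ^ e) s₀ → ∀ W : ForcedWalk (p ^ e) s₀, (∀ i, 1 ≤ (W.st i).shade) →
    ∀ N : ℕ, (∀ t, N ≤ t → (W.st (t + 1)).shade = (W.st t).shade) →
    (∀ t, N ≤ t → ordZero (W.st t).F ≠ ((p ^ e : ℕ) : ℕ∞)) → (∀ M : ℕ, ∃ t, M ≤ t ∧ StaysOnNewest W t) →
    (∀ M : ℕ, ∃ t, M ≤ t ∧ W.b t ≠ 0) →
    ∀ s : ℕ, (W.st N).shade = (s : ℕ∞) → 3 ≤ s → p ^ e + 3 ≤ 3 * s → p ^ e + 1 ≤ 2 * s →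
    (∀ (k : Fin 3) (N' : ℕ), ∃ t, N' ≤ t ∧ (W.j t = k ∨ W.b t k ≠ 0)) → False

/-- By letter. [folklore] -/
theorem highPlanar_of_subPlanar (h : NoSubcriticalPlanarJointTailsDeep) : NoHighPlanarJointTailsDeep :=
  fun p hp e he K _ _ _ _ s₀ hs W hW N hN hex hrec htr s hsN h3 hsub _ k N' hP =>
    h p hp e he K s₀ hs W hW N hN hex hrec htr s hsN h3 hsub k N' hP

/-- By letter. [folklore] -/
theorem highSkew_of_subSkew (h : NoSubcriticalSkewJointTailsDeep) : NoHighSkewJointTailsDeep :=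
  fun p hp e he K _ _ _ _ s₀ hs W hW N hN hex hrec htr s hsN h3 hsub _ hsk =>
    h p hp e he K s₀ hs W hW N hN hex hrec htr s hsN h3 hsub hsk

end BookingHalf

end Summit.ResolutionOfSingularities.ResolutionOfSingularities.Theorems.FreezeCut
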